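import Mathlib.Geometry.Manifold.VectorBundle.Tangent
import Mathlib.Geometry.Manifold.MFDeriv.Tangent
import Mathlib.Geometry.Manifold.MFDeriv.Atlas
import Mathlib.Geometry.Manifold.ContMDiff.Atlas
import Mathlib.Geometry.Manifold.ContMDiff.NormedSpace
import Mathlib.Geometry.Manifold.Instances.Real
import Mathlib.Analysis.InnerProductSpace.PiL2

/-!
# The coordinate almost complex structure on a chart target

Crux `WitnessCharge` (item stmt-SmoothPoincare4-7824, route route-SmoothPoincare4-SullivanDual),
line `Sketch`, stub `helper_chartJ` (frontier dichotomy (P5) of Gromov's pencil: chart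
localisation of the almost complex structure `J`).

Let `M` be a `C^∞` manifold modelled on `ℝ⁴ = EuclideanSpace ℝ (Fin 4)` and let `J` be a field
of endomorphisms of the tangent spaces with `J² = -1` whose expression in the trivialization of
the tangent bundle at `x₀`, `x ↦ inTangentCoordinates (𝓡 4) (𝓡 4) id id J x₀ x`, is `C^∞` on the
chart domain of `x₀` (for every `x₀`). Then on the target of the extended chart at `x₀` the field
`Jc y := inTangentCoordinates (𝓡 4) (𝓡 4) id id J x₀ ((extChartAt (𝓡 4) x₀).symm y)` is a `C^∞`
almost complex structure (`Jc y ∘ Jc y = -1`) which, read back through the chart, is the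
coordinate expression of `J`.

Proof.
* Smoothness: compose the hypothesis with the `C^∞` inverse extended chart
  (`contMDiffOn_extChartAt_symm`, which maps the target into the chart domain,
  `PartialEquiv.map_target` + `extChartAt_source`) and pass to `ContDiffOn` between vector
  spaces (`contMDiffOn_iff_contDiffOn`).
* `Jc² = -1`: for `x` in the chart domain of `x₀`, `inTangentCoordinates_eq` gives
  `inTangentCoordinates … x₀ x = A ∘L J x ∘L B` with `A = tangentCoordChange (𝓡 4) x x₀ x` and
  `B = tangentCoordChange (𝓡 4) x₀ x x`, which are mutually inverse
  (`tangentCoordChange_comp`, `tangentCoordChange_self`); hence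
  `(A J B)(A J B) v = A (J (J (B v))) = A (-(B v)) = -v`.
* Compatibility: `(extChartAt x₀).symm (extChartAt x₀ x) = x` on the chart domain
  (`PartialEquiv.left_inv`, `extChartAt_source`).
-/

noncomputable section

set_option linter.dupNamespace false

open scoped Manifold ContDiff Topology
open Set Filter

namespace Summit.SmoothPoincare4.SmoothPoincare4.Theorems.WitnessCharge.PencilIncompleteness

/-- **The coordinate almost complex structure on a chart target.** Let `J` be a field of
endomorphisms of the tangent spaces of a `C^∞` manifold `M` modelled on `ℝ⁴` with `J x ∘ J x = -1`,
whose coordinate expression `x ↦ inTangentCoordinates (𝓡 4) (𝓡 4) id id J x₀ x` in the frame at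
`x₀` is `C^∞` on the chart domain of `x₀`, for every `x₀`. Then for every `x₀` there is a field
`Jc` of endomorphisms of `ℝ⁴` which is `C^∞` on the target of the extended chart at `x₀`,
satisfies `Jc y (Jc y v) = -v` there, and agrees with the coordinate expression of `J` along the
chart: `Jc (extChartAt (𝓡 4) x₀ x) = inTangentCoordinates (𝓡 4) (𝓡 4) id id J x₀ x` for `x` in
the chart domain. Take `Jc y := inTangentCoordinates … x₀ ((extChartAt (𝓡 4) x₀).symm y)`;
smoothness is `contMDiffOn_extChartAt_symm` + `contMDiffOn_iff_contDiffOn`, the square is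
computed through `inTangentCoordinates_eq` and the cocycle identities
`tangentCoordChange_comp` / `tangentCoordChange_self`, and the compatibility is
`PartialEquiv.left_inv`. -/
theorem helper_chartJ :
    ∀ (M : Type) [TopologicalSpace M] [ChartedSpace (EuclideanSpace ℝ (Fin 4)) M]
      [IsManifold (𝓡 4) ∞ M]
      (J : ∀ x : M, TangentSpace (𝓡 4) x →L[ℝ] TangentSpace (𝓡 4) x),
      (∀ (x : M) (v : TangentSpace (𝓡 4) x), J x (J x v) = -v) →
      (∀ x₀ : M, ContMDiffOn (𝓡 4) 𝓘(ℝ, EuclideanSpace ℝ (Fin 4) →L[ℝ] EuclideanSpace ℝ (Fin 4)) ∞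
        (inTangentCoordinates (𝓡 4) (𝓡 4) (id : M → M) id (fun x => J x) x₀)
        (chartAt (EuclideanSpace ℝ (Fin 4)) x₀).source) →
      ∀ x₀ : M, ∃ Jc : EuclideanSpace ℝ (Fin 4) → EuclideanSpace ℝ (Fin 4) →L[ℝ] EuclideanSpace ℝ (Fin 4),
        ContDiffOn ℝ ∞ Jc (extChartAt (𝓡 4) x₀).target ∧
        (∀ y ∈ (extChartAt (𝓡 4) x₀).target, ∀ v, Jc y (Jc y v) = -v) ∧
        ∀ x ∈ (chartAt (EuclideanSpace ℝ (Fin 4)) x₀).source,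
          Jc (extChartAt (𝓡 4) x₀ x) =
            inTangentCoordinates (𝓡 4) (𝓡 4) (id : M → M) id (fun x => J x) x₀ x := by
  intro M _ _ _ J hJ hsm x₀
  -- points of the chart target are sent into the chart domain by the inverse extended chart
  have hsrc : ∀ y ∈ (extChartAt (𝓡 4) x₀).target,
      (extChartAt (𝓡 4) x₀).symm y ∈ (chartAt (EuclideanSpace ℝ (Fin 4)) x₀).source := fun y hy => by
    rw [← extChartAt_source (𝓡 4)]
    exact (extChartAt (𝓡 4) x₀).map_target hy
  -- the coordinate expression of `J` in the frame at `x₀`, as `A ∘ J x ∘ B` with `A`, `B` inverse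
  have hexpr : ∀ {x : M}, x ∈ (chartAt (EuclideanSpace ℝ (Fin 4)) x₀).source →
      ∀ w : EuclideanSpace ℝ (Fin 4),
        inTangentCoordinates (𝓡 4) (𝓡 4) (id : M → M) id (fun x => J x) x₀ x w =
          tangentCoordChange (𝓡 4) x x₀ x (J x (tangentCoordChange (𝓡 4) x₀ x x w)) :=
    fun {x} hx w => by
    rw [inTangentCoordinates_eq (I := 𝓡 4) (I' := 𝓡 4) (id : M → M) id (fun x => J x) hx hx]
    rfl
  have hBA : ∀ {x : M}, x ∈ (chartAt (EuclideanSpace ℝ (Fin 4)) x₀).source →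
      ∀ w : EuclideanSpace ℝ (Fin 4),
        tangentCoordChange (𝓡 4) x₀ x x (tangentCoordChange (𝓡 4) x x₀ x w) = w :=
    fun {x} hx w => by
    have hx' : x ∈ (extChartAt (𝓡 4) x₀).source := by rwa [extChartAt_source]
    rw [tangentCoordChange_comp ⟨⟨mem_extChartAt_source x, hx'⟩, mem_extChartAt_source x⟩]
    exact tangentCoordChange_self (mem_extChartAt_source x)
  have hAB : ∀ {x : M}, x ∈ (chartAt (EuclideanSpace ℝ (Fin 4)) x₀).source →
      ∀ w : EuclideanSpace ℝ (Fin 4),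
        tangentCoordChange (𝓡 4) x x₀ x (tangentCoordChange (𝓡 4) x₀ x x w) = w :=
    fun {x} hx w => by
    have hx' : x ∈ (extChartAt (𝓡 4) x₀).source := by rwa [extChartAt_source]
    rw [tangentCoordChange_comp ⟨⟨hx', mem_extChartAt_source x⟩, hx'⟩]
    exact tangentCoordChange_self hx'
  refine ⟨fun y => inTangentCoordinates (𝓡 4) (𝓡 4) (id : M → M) id (fun x => J x) x₀
      ((extChartAt (𝓡 4) x₀).symm y), ?_, ?_, ?_⟩
  · -- smoothness on the chart target
    have hmaps : (extChartAt (𝓡 4) x₀).target ⊆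
        (extChartAt (𝓡 4) x₀).symm ⁻¹' (chartAt (EuclideanSpace ℝ (Fin 4)) x₀).source :=
      fun y hy => hsrc y hy
    exact contMDiffOn_iff_contDiffOn.1 ((hsm x₀).comp (contMDiffOn_extChartAt_symm x₀) hmaps)
  · -- `Jc y ∘ Jc y = -1` on the chart target
    intro y hy v
    have hx := hsrc y hy
    dsimp only
    rw [hexpr hx, hexpr hx, hBA hx, hJ]
    exact ((tangentCoordChange (𝓡 4) _ x₀ _).map_neg _).trans (congrArg Neg.neg (hAB hx v))
  · -- compatibility with the coordinate expression along the chart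
    intro x hx
    have hx' : x ∈ (extChartAt (𝓡 4) x₀).source := by rwa [extChartAt_source]
    dsimp only
    rw [(extChartAt (𝓡 4) x₀).left_inv hx']

end Summit.SmoothPoincare4.SmoothPoincare4.Theorems.WitnessCharge.PencilIncompleteness
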